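import Summits.CriticalPhenomena.PercolationContinuityZ3.Theorems.SahiIsingConditioning

/-!
# Box-TP₂ ⟺ monotonic: the density-free form of Grimmett's equivalence "FKG lattice condition ⟺ monotonicity"

Support file of the Sahi cell (`prim-sahi`, typer seat, generation 15; `--supports stmt-CriticalPhenomena-4575`).
Theorems only (no definitions, no named facts, no sorries).

`SahiBoxTP2Conditioning.lean` proved: a box-TP₂ law is MONOTONIC — for boxes `[a₁,b₁] ≤ [a₂,b₂]` in the strong
set order and every measurable up-set `U`, `μ(U ∩ [a₁,b₁]) μ[a₂,b₂] ≤ μ[a₁,b₁] μ(U ∩ [a₂,b₂])`.  Here is the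
CONVERSE, valid on ANY measurable lattice and needing only the principal rays `U = {≥ a}` (and the dual form with
`D = {≤ b}`, equivalent to the up-set form for finite measures): two applications of monotonicity — to the pair
`[a ∧ a', b] ≤ [a', b ∨ b']` with the ray `{≥ a}`, and to the same pair with the co-ray `{≤ b'}` — multiply to
`μ[a,b] μ[a',b'] · P Q ≤ μ[a ∧ a', b ∧ b'] μ[a ∨ a', b ∨ b'] · P Q` with `P = μ[a', b ∨ b']`, `Q = μ[a ∧ a', b]`, and
`P = 0` or `Q = 0` forces a zero on the left.  So for finite measures on `Q_d`, the Hilbert cube, `ℝ^d`,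
`{−1,+1}^ι`:

  **`IsBoxTP2 μ` ⟺ boxes in the strong set order are stochastically ordered under `μ`**

(`isBoxTP2_iff_cond_Icc_mono_cube/_hilbert/_real/_spinConfig`) — the measure-level, density-free form of
Grimmett's Theorem 2.27 (*The Random-Cluster Model*: for strictly positive weights on a finite product of two-point
chains, FKG lattice condition ⟺ strong positive association ⟺ monotonic ⟺ 1-monotonic; tree
`HolleyCriterion.isMonotonic_iff_isLogSupermodular`), with no positivity assumption and for singular /
infinite-volume laws.

* `isBoxTP2_of_ray_mono` — the converse from the two ray conditions (any measurable lattice, any measure);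
* `lowerSet_mono_of_upperSet_mono` — for finite measures the down-set form follows from the up-set form;
* `isBoxTP2_of_cond_Icc_mono` — the converse from the up-set form; the `iff`s in the four settings.

No sorries, no new axioms.
-/

noncomputable section

namespace Summit.CriticalPhenomena.PercolationContinuityZ3.Theorems.SahiBoxTP2

open MeasureTheory Set Function
open scoped ENNReal unitInterval

section LatticeLemmas

variable {Ω : Type*} [Lattice Ω]

/-- `[a ∧ a', b] ∩ {≥ a} = [a, b]`. [folklore] -/
theorem Ici_inter_Icc_inf_left (a a' b : Ω) : Ici a ∩ Icc (a ⊓ a') b = Icc a b :=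
  Set.ext fun _ => ⟨fun h => ⟨h.1, h.2.2⟩, fun h => ⟨h.1, inf_le_left.trans h.1, h.2⟩⟩

/-- `[a', b ∨ b'] ∩ {≥ a} = [a ∨ a', b ∨ b']`. [folklore] -/
theorem Ici_inter_Icc_sup_right (a a' b b' : Ω) : Ici a ∩ Icc a' (b ⊔ b') = Icc (a ⊔ a') (b ⊔ b') :=
  Set.ext fun _ => ⟨fun h => ⟨sup_le h.1 h.2.1, h.2.2⟩, fun h => ⟨le_sup_left.trans h.1, le_sup_right.trans h.1, h.2⟩⟩

/-- `[a', b ∨ b'] ∩ {≤ b'} = [a', b']`. [folklore] -/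
theorem Iic_inter_Icc_sup_right (a' b b' : Ω) : Iic b' ∩ Icc a' (b ⊔ b') = Icc a' b' :=
  Set.ext fun _ => ⟨fun h => ⟨h.2.1, h.1⟩, fun h => ⟨h.2, h.1, h.2.trans le_sup_right⟩⟩

/-- `[a ∧ a', b] ∩ {≤ b'} = [a ∧ a', b ∧ b']`. [folklore] -/
theorem Iic_inter_Icc_inf_left (a a' b b' : Ω) : Iic b' ∩ Icc (a ⊓ a') b = Icc (a ⊓ a') (b ⊓ b') :=
  Set.ext fun _ => ⟨fun h => ⟨h.2.1, le_inf h.2.2 h.1⟩, fun h => ⟨h.2.trans inf_le_right, h.1, h.2.trans inf_le_left⟩⟩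

end LatticeLemmas

section Converse

variable {Ω : Type*} [MeasurableSpace Ω] [Lattice Ω]

/-- **Monotonic ⟹ box-TP₂ (any measurable lattice, any measure)**: if for all boxes `[a₁,b₁] ≤ [a₂,b₂]` in the
strong set order the principal rays satisfy `μ({≥c} ∩ [a₁,b₁]) μ[a₂,b₂] ≤ μ[a₁,b₁] μ({≥c} ∩ [a₂,b₂])` and the
co-rays satisfy `μ({≤c} ∩ [a₂,b₂]) μ[a₁,b₁] ≤ μ[a₂,b₂] μ({≤c} ∩ [a₁,b₁])`, then `μ` is box-TP₂. [this work] -/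
theorem isBoxTP2_of_ray_mono {μ : Measure Ω} [IsFiniteMeasure μ]
    (hup : ∀ a₁ b₁ a₂ b₂ c : Ω, a₁ ≤ a₂ → b₁ ≤ b₂ →
      μ (Ici c ∩ Icc a₁ b₁) * μ (Icc a₂ b₂) ≤ μ (Icc a₁ b₁) * μ (Ici c ∩ Icc a₂ b₂))
    (hdn : ∀ a₁ b₁ a₂ b₂ c : Ω, a₁ ≤ a₂ → b₁ ≤ b₂ →
      μ (Iic c ∩ Icc a₂ b₂) * μ (Icc a₁ b₁) ≤ μ (Icc a₂ b₂) * μ (Iic c ∩ Icc a₁ b₁)) : IsBoxTP2 μ := by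
  intro a b a' b'
  -- the pair `[a ∧ a', b] ≤ [a', b ∨ b']`
  have h1 := hup (a ⊓ a') b a' (b ⊔ b') a inf_le_right le_sup_left
  have h2 := hdn (a ⊓ a') b a' (b ⊔ b') b' inf_le_right le_sup_left
  rw [Ici_inter_Icc_inf_left, Ici_inter_Icc_sup_right] at h1
  rw [Iic_inter_Icc_sup_right, Iic_inter_Icc_inf_left] at h2
  -- `h1 : μ[a,b] P ≤ Q μ[a∨a',b∨b']`, `h2 : μ[a',b'] Q ≤ P μ[a∧a',b∧b']`, `P = μ[a',b∨b']`, `Q = μ[a∧a',b]`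
  set P := μ (Icc a' (b ⊔ b')) with hP
  set Q := μ (Icc (a ⊓ a') b) with hQ
  by_cases hP0 : P = 0
  · have : μ (Icc a' b') = 0 := measure_mono_null (Icc_subset_Icc_right le_sup_right) hP0
    rw [this, mul_zero]; exact zero_le
  by_cases hQ0 : Q = 0
  · have : μ (Icc a b) = 0 := measure_mono_null (Icc_subset_Icc_left inf_le_left) hQ0
    rw [this, zero_mul]; exact zero_le
  have hPQ0 : P * Q ≠ 0 := mul_ne_zero hP0 hQ0
  have hPQt : P * Q ≠ ∞ := ENNReal.mul_ne_top (measure_ne_top _ _) (measure_ne_top _ _)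
  rw [← ENNReal.mul_le_mul_iff_left hPQ0 hPQt]
  calc μ (Icc a b) * μ (Icc a' b') * (P * Q) = (μ (Icc a b) * P) * (μ (Icc a' b') * Q) := by ring
    _ ≤ (Q * μ (Icc (a ⊔ a') (b ⊔ b'))) * (P * μ (Icc (a ⊓ a') (b ⊓ b'))) := mul_le_mul' h1 h2
    _ = μ (Icc (a ⊓ a') (b ⊓ b')) * μ (Icc (a ⊔ a') (b ⊔ b')) * (P * Q) := by ring

/-- **For finite measures the co-ray (down-set) form follows from the up-set form**: from
`μ(U ∩ B) μ(B') ≤ μ(B) μ(U ∩ B')` for all measurable up-sets `U` (boxes `B ≤ B'`) one gets, for every measurable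
down-set `D`, `μ(D ∩ B') μ(B) ≤ μ(B') μ(D ∩ B)` (complements). [this work] -/
theorem lowerSet_mono_of_upperSet_mono {μ : Measure Ω} [IsFiniteMeasure μ] {B B' : Set Ω}
    (hup : ∀ U : Set Ω, IsUpperSet U → MeasurableSet U → μ (U ∩ B) * μ B' ≤ μ B * μ (U ∩ B'))
    {D : Set Ω} (hD : IsLowerSet D) (hDm : MeasurableSet D) : μ (D ∩ B') * μ B ≤ μ B' * μ (D ∩ B) := by
  have h := hup Dᶜ hD.compl hDm.compl
  -- pass to real numbers
  have hr : μ.real (Dᶜ ∩ B) * μ.real B' ≤ μ.real B * μ.real (Dᶜ ∩ B') := by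
    simp only [measureReal_def, ← ENNReal.toReal_mul]
    exact ENNReal.toReal_mono (ENNReal.mul_ne_top (measure_ne_top _ _) (measure_ne_top _ _)) h
  have hsd : ∀ S : Set Ω, Dᶜ ∩ S = S \ D := fun S => by rw [sdiff_eq, inter_comm]
  have e1 : μ.real (Dᶜ ∩ B) = μ.real B - μ.real (D ∩ B) := by
    have h := measureReal_inter_add_sdiff (μ := μ) (s := B) hDm
    rw [hsd, inter_comm]
    linarith
  have e2 : μ.real (Dᶜ ∩ B') = μ.real B' - μ.real (D ∩ B') := by
    have h := measureReal_inter_add_sdiff (μ := μ) (s := B') hDm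
    rw [hsd, inter_comm]
    linarith
  rw [e1, e2] at hr
  have hr' : μ.real (D ∩ B') * μ.real B ≤ μ.real B' * μ.real (D ∩ B) := by nlinarith [hr]
  simp only [measureReal_def, ← ENNReal.toReal_mul] at hr'
  exact (ENNReal.toReal_le_toReal (ENNReal.mul_ne_top (measure_ne_top _ _) (measure_ne_top _ _))
    (ENNReal.mul_ne_top (measure_ne_top _ _) (measure_ne_top _ _))).1 hr'

/-- **Monotonic ⟹ box-TP₂ from the up-set form alone** (finite measure, measurable rays). [this work] -/
theorem isBoxTP2_of_cond_Icc_mono {μ : Measure Ω} [IsFiniteMeasure μ]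
    (hIci : ∀ a : Ω, MeasurableSet (Ici a)) (hIic : ∀ b : Ω, MeasurableSet (Iic b))
    (hmono : ∀ a₁ b₁ a₂ b₂ : Ω, a₁ ≤ a₂ → b₁ ≤ b₂ → ∀ U : Set Ω, IsUpperSet U → MeasurableSet U →
      μ (U ∩ Icc a₁ b₁) * μ (Icc a₂ b₂) ≤ μ (Icc a₁ b₁) * μ (U ∩ Icc a₂ b₂)) : IsBoxTP2 μ :=
  isBoxTP2_of_ray_mono (fun a₁ b₁ a₂ b₂ c ha hb => hmono a₁ b₁ a₂ b₂ ha hb (Ici c) (isUpperSet_Ici c) (hIci c))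
    fun a₁ b₁ a₂ b₂ c ha hb => lowerSet_mono_of_upperSet_mono (hmono a₁ b₁ a₂ b₂ ha hb) (isLowerSet_Iic c) (hIic c)

end Converse

/-! ### The equivalences -/

section Iff

variable {d : ℕ}

/-- **`Q_d`: box-TP₂ ⟺ monotonic.**  A finite measure on `[0,1]^d` is box-TP₂ iff boxes in the strong set order
are stochastically ordered under it (`μ(U ∩ [a₁,b₁]) μ[a₂,b₂] ≤ μ[a₁,b₁] μ(U ∩ [a₂,b₂])` for `a₁ ≤ a₂`, `b₁ ≤ b₂`
and all measurable up-sets `U`). [this work] -/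
theorem isBoxTP2_iff_cond_Icc_mono_cube (μ : Measure (Fin d → I)) [IsFiniteMeasure μ] :
    IsBoxTP2 μ ↔ ∀ a₁ b₁ a₂ b₂ : Fin d → I, a₁ ≤ a₂ → b₁ ≤ b₂ → ∀ U : Set (Fin d → I), IsUpperSet U →
      MeasurableSet U → μ (U ∩ Icc a₁ b₁) * μ (Icc a₂ b₂) ≤ μ (Icc a₁ b₁) * μ (U ∩ Icc a₂ b₂) :=
  ⟨fun hμ _ _ _ _ ha hb _ hU hUm => hμ.cond_Icc_mono_cube μ ha hb hU hUm,
    isBoxTP2_of_cond_Icc_mono (fun _ => measurableSet_Ici) (fun _ => measurableSet_Iic)⟩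

/-- **Hilbert cube `[0,1]^ℕ`: box-TP₂ ⟺ monotonic.** [this work] -/
theorem isBoxTP2_iff_cond_Icc_mono_hilbert (μ : Measure (ℕ → I)) [IsFiniteMeasure μ] :
    IsBoxTP2 μ ↔ ∀ a₁ b₁ a₂ b₂ : ℕ → I, a₁ ≤ a₂ → b₁ ≤ b₂ → ∀ U : Set (ℕ → I), IsUpperSet U →
      MeasurableSet U → μ (U ∩ Icc a₁ b₁) * μ (Icc a₂ b₂) ≤ μ (Icc a₁ b₁) * μ (U ∩ Icc a₂ b₂) :=
  ⟨fun hμ _ _ _ _ ha hb _ hU hUm => hμ.cond_Icc_mono_hilbert μ ha hb hU hUm,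
    isBoxTP2_of_cond_Icc_mono (fun _ => measurableSet_Ici) (fun _ => measurableSet_Iic)⟩

/-- **`ℝ^d`: box-TP₂ ⟺ monotonic.** [this work] -/
theorem isBoxTP2_iff_cond_Icc_mono_real (μ : Measure (Fin d → ℝ)) [IsFiniteMeasure μ] :
    IsBoxTP2 μ ↔ ∀ a₁ b₁ a₂ b₂ : Fin d → ℝ, a₁ ≤ a₂ → b₁ ≤ b₂ → ∀ U : Set (Fin d → ℝ), IsUpperSet U →
      MeasurableSet U → μ (U ∩ Icc a₁ b₁) * μ (Icc a₂ b₂) ≤ μ (Icc a₁ b₁) * μ (U ∩ Icc a₂ b₂) :=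
  ⟨fun hμ _ _ _ _ ha hb _ hU hUm => hμ.cond_Icc_mono_real μ ha hb hU hUm,
    isBoxTP2_of_cond_Icc_mono (fun _ => measurableSet_Ici) (fun _ => measurableSet_Iic)⟩

/-- **`{−1,+1}^ι` (`ι` countably infinite): box-TP₂ ⟺ monotonic** — the density-free, infinite-volume form of
Grimmett's Theorem 2.27 ("FKG lattice condition ⟺ monotonic") with no positivity assumption. [this work] -/
theorem isBoxTP2_iff_cond_Icc_mono_spinConfig {ι : Type*} [Countable ι] [Infinite ι] (μ : Measure (ι → ℤˣ))
    [IsFiniteMeasure μ] :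
    IsBoxTP2 μ ↔ ∀ a₁ b₁ a₂ b₂ : ι → ℤˣ, a₁ ≤ a₂ → b₁ ≤ b₂ → ∀ U : Set (ι → ℤˣ), IsUpperSet U →
      MeasurableSet U → μ (U ∩ Icc a₁ b₁) * μ (Icc a₂ b₂) ≤ μ (Icc a₁ b₁) * μ (U ∩ Icc a₂ b₂) :=
  ⟨fun hμ _ _ _ _ ha hb _ hU hUm => hμ.cond_Icc_mono_spinConfig μ ha hb hU hUm,
    isBoxTP2_of_cond_Icc_mono measurableSet_Ici_spinConfig measurableSet_Iic_spinConfig⟩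

end Iff



end Summit.CriticalPhenomena.PercolationContinuityZ3.Theorems.SahiBoxTP2
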